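import Literature.NumberTheory.Irrationality.Zudilin2003.CatalanRecursion
import Literature.NumberTheory.Transcendental.ZetaLinearFormsCriterion
import HarnessLib

/-!
# Zudilin 2002: "A few remarks on linear forms involving Catalan's constant"

Source: W. Zudilin, *A few remarks on linear forms involving Catalan's constant*, arXiv:math/0210423
(English version of Chebyshevskiĭ Sbornik **3** (2002), no. 2(4), 60–70) [Zudilin2002CatalanRemarks].
It sharpens and complements [Zudilin2003Catalan] (typed in `CatalanRecursion.lean`, whose `u`, `v`,
recursion (2) and `D_m = Nat.lcmUpto m` this file reuses).

HONEST FRAMING (cell `pub-zeta5`): systematic search; no irrationality claim unless certified.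
This file types PUBLISHED statements only:

* **Theorem 1** (Sect. 1) as a NAMED FACT `remarksTheorem1`: the inclusions
  `2^{4n+o(n)} u_n ∈ ℤ`, `2^{4n+o(n)} D_{2n-1}² v_n ∈ ℤ` for the solutions `u_n, v_n` of the recursion (2)–(4)
  of [Zudilin2003Catalan] (there, Theorem 1 proves only `2^{4n+3} D_n u_n ∈ ℤ`, `2^{4n+3} D_{2n-1}³ v_n ∈ ℤ`,
  and Sect. 4 reports `2^{4n} u_n ∈ ℤ`, `2^{4n} D_{2n-1}² v_n ∈ ℤ` as experimental for `n ≤ 1000`); the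
  `o(n)` "is of order `log₂(2n)`" (Remark after Theorem 1).  Proof in print: Whipple's `₆F₅(−1) → ₃F₂(1)`
  transform and a Barnes integral give a second representation (7)–(11) of `u_n G − v_n` whose partial-fraction
  coefficients satisfy `2^{6n+4} A_l ∈ ℤ` (integer-valued polynomials at quarter-integers), hence
  `2^{6n} u_n, 2^{6n} D_{2n-1}² v_n ∈ ℤ`; combined with Theorem 1 of [Zudilin2003Catalan].  Not re-proved here.
* a PROVED corollary `remarksTheorem1.tendsto_log_denom`: the denominators `2^{4n+e(n)} D_{2n-1}²` the theorem
  provides have exponential type `4 log 2 + 4 = 6.77258872…` (prime number theorem, tree lemma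
  `tendsto_log_lcmUpto_div`) — i.e. asymptotically the SAME type as the experimentally observed denominators
  `2^{4n} D_{2n-1}²`, against `4 log 2 + 6` for the denominators of [Zudilin2003Catalan, Theorem 1].
* **Theorem 2** (Sect. 2): the SECOND Apéry-like recursion (13) for Catalan's constant — typed as
  DEFINITIONS (`pT`, `qT`, `IsSolutionT`, its solver `solT` and the two solutions `uT`, `vT` with the printed
  initial data `ũ₀ = 0, ũ₁ = 6`, `ṽ₀ = −1, ṽ₁ = 5`; the rational function `R̃_n(t)` of (12)) — and its
  assertions as a NAMED FACT `remarksTheorem2`: the series (12) `ũ_n G − ṽ_n = −Σ_{ν≥1} R̃_n′(ν)` (`n ≥ 1`),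
  the rates `|ũ_n G − ṽ_n|^{1/n} → ((√5−1)/2)⁵`, `ũ_n^{1/n} → ((1+√5)/2)⁵`, and the inclusions (14)
  `2^{4n+o(n)} ũ_n ∈ ℤ`, `2^{4n+o(n)} D_{2n-1}² ṽ_n ∈ ℤ`.  (In the source `ũ_n, ṽ_n` are DEFINED by the
  series (12) and Theorem 2 asserts the recursion; here, as in `CatalanRecursion.lean`, the recursion defines
  them and the series identity is part of the fact.  Exact check, cell pub-zeta5 lit seat 2026-08-20:
  `ũ₂ = 115/2`, `ṽ₂ = 1897/36`, `ṽ_n/ũ_n − G ≈ 1.3·10⁻⁸³` at `n = 40`, series (12) `=` form to `10⁻¹⁴`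
  for `n ≤ 6`, and `2^{4n} ũ_n, 2^{4n} D_{2n-1}² ṽ_n ∈ ℤ` for `n ≤ 40`.)

NOT here: the continued fraction `6G = 5 + 516/q(2) + …` and the Euler-type double integral of Sect. 2;
Sect. 3 (the `c`-permutation group `𝔊` of order 120 and Theorem 3, `H(c) ∈ ℚG + ℚ`); the EXPECTED inclusion
(24) `2^{2M+o(M)} D_{m₁} D_{m₂} H(c) ∈ ℤG + ℤ` (a conjecture in the source, "beyond the reach of even the
group-structure approach"); and the Conjecture of Sect. 4 (geometric condition ⇒ rational characteristic roots,
which would imply `G ∉ ℚ`) — conjectures are not Literature.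
-/

noncomputable section

open Finset Filter Set
open scoped Topology

namespace Literature.NumberTheory.Irrationality.Zudilin2003

open Literature.NumberTheory.Transcendental (catalanConstant tendsto_log_lcmUpto_div)

/-! ### Theorem 1: the sharper inclusions, up to `2^{o(n)}` -/

/-- **Theorem 1 of [Zudilin2002CatalanRemarks]** (named fact, not proved here): for `n = 0, 1, 2, …`,
`2^{4n+o(n)} u_n ∈ ℤ` and `2^{4n+o(n)} D_{2n-1}² v_n ∈ ℤ`, where `u_n, v_n` are the solutions (4) of the
recursion (2) of [Zudilin2003Catalan] and `D_m = lcm(1,…,m)`; "the `o(n)`-term is of order `log₂(2n)`"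
(Remark).  Rendered with one exponent sequence `e : ℕ → ℕ`, `e(n)/n → 0` (a nonnegative `e` is no loss:
enlarging the power of `2` preserves integrality). [cite: Zudilin2002CatalanRemarks, Sect. 1, Theorem 1, eq. (3) and Remark] -/
def remarksTheorem1 : Prop :=
  ∃ e : ℕ → ℕ, Tendsto (fun n : ℕ => (e n : ℝ) / n) atTop (𝓝 0) ∧
    ∀ n : ℕ, (∃ z : ℤ, (z : ℚ) = 2 ^ (4 * n + e n) * u n)
      ∧ (∃ z : ℤ, (z : ℚ) = 2 ^ (4 * n + e n) * (Nat.lcmUpto (2 * n - 1) : ℚ) ^ 2 * v n)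

/-- `log D_{2n-1} / n → 2` (prime number theorem, via the tree lemma `log D_N / N → 1`). [folklore] -/
private theorem tendsto_log_lcmUpto_two_mul_sub_one_div :
    Tendsto (fun n : ℕ => Real.log (Nat.lcmUpto (2 * n - 1)) / n) atTop (𝓝 2) := by
  have hsub : Tendsto (fun n : ℕ => 2 * n - 1) atTop atTop := by
    refine tendsto_atTop_atTop.mpr fun b => ⟨b + 1, fun n hn => by omega⟩
  have h1 : Tendsto (fun n : ℕ => Real.log (Nat.lcmUpto (2 * n - 1)) / ((2 * n - 1 : ℕ) : ℝ)) atTop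
      (𝓝 1) := tendsto_log_lcmUpto_div.comp hsub
  have h2 : Tendsto (fun n : ℕ => (((2 * n - 1 : ℕ) : ℝ)) / n) atTop (𝓝 2) := by
    have e : (fun n : ℕ => (((2 * n - 1 : ℕ) : ℝ)) / n) =ᶠ[atTop] fun n => 2 - 1 / (n : ℝ) := by
      filter_upwards [eventually_ge_atTop 1] with n hn
      have hn' : (n : ℝ) ≠ 0 := by exact_mod_cast (show n ≠ 0 by omega)
      rw [Nat.cast_sub (by omega)]
      push_cast
      field_simp
    rw [tendsto_congr' e]
    have : Tendsto (fun n : ℕ => (2 : ℝ) - 1 / (n : ℝ)) atTop (𝓝 (2 - 0)) :=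
      tendsto_const_nhds.sub tendsto_one_div_atTop_nhds_zero_nat
    simpa using this
  have h3 := h1.mul h2
  simp only [one_mul] at h3
  refine h3.congr' ?_
  filter_upwards [eventually_ge_atTop 1] with n hn
  have hn' : (n : ℝ) ≠ 0 := by exact_mod_cast (show n ≠ 0 by omega)
  have hm' : (((2 * n - 1 : ℕ) : ℝ)) ≠ 0 := by exact_mod_cast (show 2 * n - 1 ≠ 0 by omega)
  field_simp

/-- **PROVED corollary of Theorem 1: the exponential type of the proved denominators.**  Theorem 1 yields
integer multipliers `Q_n = 2^{4n+e(n)} D_{2n-1}²` for `(u_n, v_n)` with `(log Q_n)/n → 4 log 2 + 4`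
(`= 6.77258872…`), the same type as the observed denominators `2^{4n} D_{2n-1}²` and smaller than the type
`4 log 2 + 6` of `2^{4n+3} D_{2n-1}³` from [Zudilin2003Catalan, Theorem 1].  (As the source notes in Sect. 4,
this still does not yield the irrationality of `G`: `6.77… > 2·2.406…`.)
[cite: Zudilin2002CatalanRemarks, Sect. 1, Theorem 1; Sect. 4] -/
theorem remarksTheorem1.tendsto_log_denom (h : remarksTheorem1) :
    ∃ e : ℕ → ℕ,
      (∀ n : ℕ, (∃ z : ℤ, (z : ℚ) = 2 ^ (4 * n + e n) * u n)
        ∧ (∃ z : ℤ, (z : ℚ) = 2 ^ (4 * n + e n) * (Nat.lcmUpto (2 * n - 1) : ℚ) ^ 2 * v n))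
      ∧ Tendsto (fun n : ℕ => Real.log ((2 : ℝ) ^ (4 * n + e n) * (Nat.lcmUpto (2 * n - 1) : ℝ) ^ 2) / n)
          atTop (𝓝 (4 * Real.log 2 + 4)) := by
  obtain ⟨e, he, hincl⟩ := h
  refine ⟨e, hincl, ?_⟩
  -- `(4n + e(n)) log 2 / n → 4 log 2` and `2 log D_{2n-1} / n → 4`
  have hA : Tendsto (fun n : ℕ => ((4 * n + e n : ℕ) : ℝ) * Real.log 2 / n) atTop (𝓝 (4 * Real.log 2)) := by
    have h4 : Tendsto (fun n : ℕ => (4 + (e n : ℝ) / n) * Real.log 2) atTop (𝓝 ((4 + 0) * Real.log 2)) :=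
      (tendsto_const_nhds.add he).mul_const _
    rw [add_zero] at h4
    refine h4.congr' ?_
    filter_upwards [eventually_ge_atTop 1] with n hn
    have hn' : (n : ℝ) ≠ 0 := by exact_mod_cast (show n ≠ 0 by omega)
    push_cast
    field_simp
  have hB := tendsto_log_lcmUpto_two_mul_sub_one_div.const_mul 2
  have hsum := hA.add hB
  rw [show (4 : ℝ) * Real.log 2 + 4 = 4 * Real.log 2 + 2 * 2 by norm_num]
  refine hsum.congr' ?_
  filter_upwards [eventually_ge_atTop 1] with n hn
  have hd : (0 : ℝ) < (Nat.lcmUpto (2 * n - 1) : ℝ) := by exact_mod_cast Nat.lcmUpto_pos _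
  have h2 : (0 : ℝ) < (2 : ℝ) ^ (4 * n + e n) := by positivity
  have hn' : (n : ℝ) ≠ 0 := by exact_mod_cast (show n ≠ 0 by omega)
  rw [Real.log_mul h2.ne' (pow_pos hd 2).ne', Real.log_pow, Real.log_pow]
  push_cast
  field_simp

/-! ### Theorem 2: the second Apéry-like recursion (13) for Catalan's constant -/

/-- `p̃(n) = 20n² − 20n + 3` (so that `p̃(n+1) = 20n² + 20n + 3`), the quadratic factor of the extreme
coefficients of (13). [cite: Zudilin2002CatalanRemarks, Sect. 2, Theorem 2, eq. (13)] -/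
def pT {R : Type*} [CommRing R] (n : R) : R := 20 * n ^ 2 - 20 * n + 3

/-- `q̃(n) = 3520n⁶ − 2672n⁴ + 196n² − 9`, the middle coefficient of (13) ("polynomials in `2n` with integer
coefficients"). [cite: Zudilin2002CatalanRemarks, Sect. 2, Theorem 2, eq. (13)] -/
def qT {R : Type*} [CommRing R] (n : R) : R := 3520 * n ^ 6 - 2672 * n ^ 4 + 196 * n ^ 2 - 9

/-- `p̃(n+1) = 20n² + 20n + 3`. [cite: Zudilin2002CatalanRemarks, Sect. 2, eq. (13)] -/
theorem pT_succ {R : Type*} [CommRing R] (n : R) : pT (n + 1) = 20 * n ^ 2 + 20 * n + 3 := by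
  unfold pT; ring

/-- A sequence `x : ℕ → ℚ` solves the difference equation (13):
`(2n)²(2n+1)²(20n²−20n+3) x_{n+1} − (3520n⁶−2672n⁴+196n²−9) x_n − (2n)²(2n+1)(2n−3)(20n²+20n+3) x_{n−1} = 0`
for all `n ≥ 1`. [cite: Zudilin2002CatalanRemarks, Sect. 2, Theorem 2, eq. (13)] -/
def IsSolutionT (x : ℕ → ℚ) : Prop :=
  ∀ n : ℕ, 1 ≤ n →
    (2 * (n : ℚ)) ^ 2 * (2 * (n : ℚ) + 1) ^ 2 * pT (n : ℚ) * x (n + 1) - qT (n : ℚ) * x n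
      - (2 * (n : ℚ)) ^ 2 * (2 * (n : ℚ) + 1) * (2 * (n : ℚ) - 3) * pT ((n : ℚ) + 1) * x (n - 1) = 0

/-- `p̃(n) > 0` for NATURAL `n` (its real roots `1/2 ± √10/10` lie in `(0,1)`; `p̃(0) = p̃(1) = 3`).
[cite: Zudilin2002CatalanRemarks, Sect. 2, eq. (13)] -/
theorem pT_pos (n : ℕ) : 0 < pT (n : ℚ) := by
  unfold pT
  rcases Nat.eq_zero_or_pos n with h | h
  · subst h; norm_num
  · have hn : (1 : ℚ) ≤ n := by exact_mod_cast h
    nlinarith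

/-- The leading coefficient `(2n)²(2n+1)² p̃(n)` of (13) is positive for `n ≥ 1`, so (13) determines `x_{n+1}`.
[cite: Zudilin2002CatalanRemarks, Sect. 2, eq. (13)] -/
theorem leadT_pos {n : ℕ} (hn : 1 ≤ n) :
    0 < (2 * (n : ℚ)) ^ 2 * (2 * (n : ℚ) + 1) ^ 2 * pT (n : ℚ) := by
  have := pT_pos n
  have hn' : (1 : ℚ) ≤ n := by exact_mod_cast hn
  positivity

/-- The step map of (13) at `n = m + 1`:
`x_{m+2} = (q̃(n) x_n + (2n)²(2n+1)(2n−3) p̃(n+1) x_{n−1}) / ((2n)²(2n+1)² p̃(n))`.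
[cite: Zudilin2002CatalanRemarks, Sect. 2, eq. (13)] -/
def stepT (m : ℕ) (x₀ x₁ : ℚ) : ℚ :=
  (qT ((m : ℚ) + 1) * x₁
      + (2 * ((m : ℚ) + 1)) ^ 2 * (2 * ((m : ℚ) + 1) + 1) * (2 * ((m : ℚ) + 1) - 3) * pT ((m : ℚ) + 1 + 1) * x₀)
    / ((2 * ((m : ℚ) + 1)) ^ 2 * (2 * ((m : ℚ) + 1) + 1) ^ 2 * pT ((m : ℚ) + 1))

/-- The solution of (13) with initial data `x₀, x₁` (the elementary solver `rec2` of `CatalanRecursion.lean`).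
[cite: Zudilin2002CatalanRemarks, Sect. 2, Theorem 2] -/
def solT (x₀ x₁ : ℚ) : ℕ → ℚ := rec2 stepT x₀ x₁

/-- `solT x₀ x₁ 0 = x₀`. [cite: Zudilin2002CatalanRemarks, Sect. 2, Theorem 2] -/
@[simp] theorem solT_zero (x₀ x₁ : ℚ) : solT x₀ x₁ 0 = x₀ := rfl

/-- `solT x₀ x₁ 1 = x₁`. [cite: Zudilin2002CatalanRemarks, Sect. 2, Theorem 2] -/
@[simp] theorem solT_one (x₀ x₁ : ℚ) : solT x₀ x₁ 1 = x₁ := rfl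

/-- The defining step of `solT`: (13) at `n = m + 1` solved for `x_{m+2}`.
[cite: Zudilin2002CatalanRemarks, Sect. 2, eq. (13)] -/
theorem solT_step (x₀ x₁ : ℚ) (m : ℕ) :
    solT x₀ x₁ (m + 2) = stepT m (solT x₀ x₁ m) (solT x₀ x₁ (m + 1)) := rfl

/-- `solT x₀ x₁` solves (13). [cite: Zudilin2002CatalanRemarks, Sect. 2, Theorem 2, eq. (13)] -/
theorem solT_isSolutionT (x₀ x₁ : ℚ) : IsSolutionT (solT x₀ x₁) := by
  intro n hn
  obtain ⟨m, rfl⟩ : ∃ m, n = m + 1 := ⟨n - 1, by omega⟩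
  have h2 := solT_step x₀ x₁ m
  have hc := leadT_pos (n := m + 1) (by omega)
  simp only [Nat.add_sub_cancel, show m + 1 + 1 = m + 2 by omega]
  push_cast at hc ⊢
  rw [h2]
  unfold stepT
  rw [mul_div_assoc', mul_div_cancel_left₀ _ hc.ne']
  ring

/-- Uniqueness for (13): two solutions with the same `x₀, x₁` coincide.
[cite: Zudilin2002CatalanRemarks, Sect. 2, Theorem 2] -/
theorem IsSolutionT.ext_of_init {x y : ℕ → ℚ} (hx : IsSolutionT x) (hy : IsSolutionT y)
    (h0 : x 0 = y 0) (h1 : x 1 = y 1) : x = y := by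
  funext n
  induction n using Nat.strong_induction_on with
  | _ n ih =>
    match n, ih with
    | 0, _ => exact h0
    | 1, _ => exact h1
    | m + 2, ih =>
      have hxm := hx (m + 1) (by omega)
      have hym := hy (m + 1) (by omega)
      have e0 : x m = y m := ih m (by omega)
      have e1 : x (m + 1) = y (m + 1) := ih (m + 1) (by omega)
      have hc := leadT_pos (n := m + 1) (by omega)
      simp only [Nat.add_sub_cancel, show m + 1 + 1 = m + 2 by omega] at hxm hym
      rw [e0, e1] at hxm
      have : (2 * ((m + 1 : ℕ) : ℚ)) ^ 2 * (2 * ((m + 1 : ℕ) : ℚ) + 1) ^ 2 * pT ((m + 1 : ℕ) : ℚ)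
          * (x (m + 2) - y (m + 2)) = 0 := by linear_combination hxm - hym
      rcases mul_eq_zero.mp this with h | h
      · exact absurd h hc.ne'
      · linarith

/-- `ũ_n`: the solution of (13) with `ũ₀ = 0, ũ₁ = 6`. [cite: Zudilin2002CatalanRemarks, Sect. 2, Theorem 2] -/
def uT : ℕ → ℚ := solT 0 6

/-- `ṽ_n`: the solution of (13) with `ṽ₀ = −1, ṽ₁ = 5`. [cite: Zudilin2002CatalanRemarks, Sect. 2, Theorem 2] -/
def vT : ℕ → ℚ := solT (-1) 5

/-- The linear form `ũ_n G − ṽ_n`. [cite: Zudilin2002CatalanRemarks, Sect. 2, eq. (12)] -/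
def formT (n : ℕ) : ℝ := (uT n : ℝ) * catalanConstant - (vT n : ℝ)

/-- `ũ₂ = 115/2` (from (13) at `n = 1`: `108 ũ₂ = 1035·6 − 516·0`). [cite: Zudilin2002CatalanRemarks, Sect. 2, eq. (13)] -/
theorem uT_two : uT 2 = 115 / 2 := by
  show stepT 0 0 6 = 115 / 2
  norm_num [stepT, pT, qT]

/-- `ṽ₂ = 1897/36` (from (13) at `n = 1`: `108 ṽ₂ = 1035·5 + 516`; `ṽ₂/ũ₂ = 0.91642…`, `G = 0.91596…`).
[cite: Zudilin2002CatalanRemarks, Sect. 2, eq. (13)] -/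
theorem vT_two : vT 2 = 1897 / 36 := by
  show stepT 0 (-1) 5 = 1897 / 36
  norm_num [stepT, pT, qT]

/-- The rational function of (12),
`R̃_n(t) = ((−1)ⁿ/2)·((2n)!/((n−1)!)²)·∏_{j=1}^{n−1}(t−j)·∏_{j=1}^{n}(t−j) / ∏_{j=0}^{2n}(2t+j−n−1/2)`
(`n ≥ 1`; over any field, junk value where the denominator vanishes, which does not happen at integers `t`).
[cite: Zudilin2002CatalanRemarks, Sect. 2, eq. (12)] -/
def RT {K : Type*} [Field K] (n : ℕ) (t : K) : K :=
  (-1 : K) ^ n / 2 * ((2 * n).factorial : K) / (((n - 1).factorial : K) ^ 2)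
    * (∏ j ∈ range (n - 1), (t - (j + 1))) * (∏ j ∈ range n, (t - (j + 1)))
    / ∏ j ∈ range (2 * n + 1), (2 * t + j - n - 1 / 2)

/-- **Theorem 2 of [Zudilin2002CatalanRemarks]** (named fact, not proved here; the recursion (13) itself is
the DEFINITION of `uT`, `vT` above): (i) the series (12): for `n ≥ 1`,
`ũ_n G − ṽ_n = −Σ_{ν=1}^{∞} R̃_n′(ν)`; (ii) the limit relations `|ũ_n G − ṽ_n|^{1/n} → ((√5−1)/2)⁵` and
`ũ_n^{1/n} → ((1+√5)/2)⁵` (the source also states `ṽ_n^{1/n} →` the same); (iii) the inclusions (14)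
`2^{4n+o(n)} ũ_n ∈ ℤ`, `2^{4n+o(n)} D_{2n−1}² ṽ_n ∈ ℤ` for `n = 0, 1, 2, …` ("a word-by-word repetition" of
the proof of Theorem 1).  Proof in print: Zeilberger's creative telescoping applied to (12).
[cite: Zudilin2002CatalanRemarks, Sect. 2, Theorem 2, eqs. (12)–(14)] -/
def remarksTheorem2 : Prop :=
  (∀ n : ℕ, 1 ≤ n →
      HasSum (fun ν : ℕ => -deriv (fun t : ℝ => RT n t) ((ν : ℝ) + 1)) (formT n))
  ∧ Tendsto (fun n : ℕ => |formT n| ^ (1 / (n : ℝ))) atTop (𝓝 (((Real.sqrt 5 - 1) / 2) ^ 5))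
  ∧ Tendsto (fun n : ℕ => ((uT n : ℚ) : ℝ) ^ (1 / (n : ℝ))) atTop (𝓝 (((1 + Real.sqrt 5) / 2) ^ 5))
  ∧ ∃ e : ℕ → ℕ, Tendsto (fun n : ℕ => (e n : ℝ) / n) atTop (𝓝 0) ∧
      ∀ n : ℕ, (∃ z : ℤ, (z : ℚ) = 2 ^ (4 * n + e n) * uT n)
        ∧ (∃ z : ℤ, (z : ℚ) = 2 ^ (4 * n + e n) * (Nat.lcmUpto (2 * n - 1) : ℚ) ^ 2 * vT n)

/-! ### Krattenthaler–Rivoal 2008: the sharper inclusions EXACTLY, for all `n` (appended by the lit seat, 2026-08-20)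

Source: C. Krattenthaler, T. Rivoal, *On a linear form for Catalan's constant*, South East Asian J. Math. Math.
Sci. **6**:2 (2008) 3–15, arXiv:0810.1927 [KrattenthalerRivoal2008Catalan].  They consider
`G_n = n! Σ_{k≥1} (−1)^k (k + (n−1)/2) (k−n)_n (k+n)_n / (k−1/2)_{n+1}³ = a_n G − b_n` (their (2.1)) and prove the
conjecture of Rivoal–Zudilin [RiZuAA]: `2^{4n} a_n ∈ ℤ` (Theorem 1) and `2^{4n} d_{2n}² b_n ∈ ℤ` (Theorem 2) for all
`n ≥ 1`, `d_m = lcm(1,…,m)`, via Andrews' multidimensional Watson transformation.  NORMALISATION BRIDGE to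
[Zudilin2003Catalan] (checked here): with `t = k − 1` their summand is `(−1)^{t+1} R_n(t)/2` for the `R_n` of
[Zudilin2003Catalan, (7)], so `G_n = −F_n/2` with `F_n = Σ_{t≥0} (−1)^t R_n(t)` of [Zudilin2003Catalan, (8)]
`= U_n′ G − V_n = 8(u_n G − v_n)` [Zudilin2003Catalan, Lemma 5]; hence `a_n = −4u_n`, `b_n = −4v_n` (numerically:
`G_n/(u_n G − v_n) = −4.000000` at `n = 1, 2`).  In the tree's normalisation the two theorems therefore read
`2^{4n+2} u_n ∈ ℤ`, `2^{4n+2} d_{2n}² v_n ∈ ℤ` (`n ≥ 1`) — the observed denominators `2^{4n} D_{2n−1}²` up to the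
bounded factor `4·(d_{2n}/D_{2n−1})² ∈ {4, 16}`, and in particular Theorem 1 of [Zudilin2002CatalanRemarks] with the
CONSTANT exponent `e(n) = 4` (`remarksTheorem1_of_krTheorems`, PROVED below). -/

/-- **Theorems 1 and 2 of [KrattenthalerRivoal2008Catalan]** (named fact, not proved here), in the normalisation of
[Zudilin2003Catalan] (`a_n = −4u_n`, `b_n = −4v_n`, see the section docstring): for every `n ≥ 1`,
`2^{4n+2} u_n ∈ ℤ` and `2^{4n+2} d_{2n}² v_n ∈ ℤ`, `d_{2n} = lcm(1,…,2n)`.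
[cite: KrattenthalerRivoal2008Catalan, Theorem 1 and Theorem 2 (with (2.1)–(2.3))] -/
def krTheorems : Prop :=
  ∀ n : ℕ, 1 ≤ n →
    (∃ z : ℤ, (z : ℚ) = 2 ^ (4 * n + 2) * u n)
      ∧ (∃ z : ℤ, (z : ℚ) = 2 ^ (4 * n + 2) * (Nat.lcmUpto (2 * n) : ℚ) ^ 2 * v n)

/-- `lcm(1,…,2n) ∣ 2·lcm(1,…,2n−1)` for `n ≥ 1` (the only new element `2n = 2·n` has `n ≤ 2n−1`). [folklore] -/
private theorem lcmUpto_two_mul_dvd (n : ℕ) (hn : 1 ≤ n) :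
    Nat.lcmUpto (2 * n) ∣ 2 * Nat.lcmUpto (2 * n - 1) := by
  unfold Nat.lcmUpto
  refine Finset.lcm_dvd fun m hm => ?_
  rw [Finset.mem_Icc] at hm
  rcases Nat.lt_or_ge m (2 * n) with h | h
  · exact (Finset.dvd_lcm (Finset.mem_Icc.mpr ⟨hm.1, by omega⟩)).trans (dvd_mul_left _ _)
  · have hm2 : m = 2 * n := le_antisymm hm.2 h
    subst hm2
    exact mul_dvd_mul_left 2 (Finset.dvd_lcm (Finset.mem_Icc.mpr ⟨hn, by omega⟩))

/-- **Krattenthaler–Rivoal ⟹ Zudilin's Theorem 1 with a constant exponent** (PROVED reduction): `krTheorems`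
gives `remarksTheorem1` with `e(n) = 4` for all `n` (at `n = 0`: `u₀ = 1`, `v₀ = 0`), using
`d_{2n}² ∣ 4·D_{2n−1}²`. [cite: KrattenthalerRivoal2008Catalan, Theorems 1–2; Zudilin2002CatalanRemarks, Theorem 1] -/
theorem remarksTheorem1_of_krTheorems (h : krTheorems) : remarksTheorem1 := by
  refine ⟨fun _ => 4, ?_, fun n => ?_⟩
  · have : Tendsto (fun n : ℕ => (4 : ℝ) * (1 / (n : ℝ))) atTop (𝓝 (4 * 0)) :=
      tendsto_one_div_atTop_nhds_zero_nat.const_mul 4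
    rw [mul_zero] at this
    refine this.congr fun n => ?_
    push_cast
    ring
  · rcases Nat.eq_zero_or_pos n with hn | hn
    · subst hn
      refine ⟨⟨16, ?_⟩, ⟨0, ?_⟩⟩ <;> norm_num [u, v]
    · obtain ⟨⟨zu, hzu⟩, ⟨zv, hzv⟩⟩ := h n hn
      obtain ⟨c, hc⟩ := lcmUpto_two_mul_dvd n hn
      refine ⟨⟨4 * zu, ?_⟩, ⟨(c : ℤ) ^ 2 * zv, ?_⟩⟩
      · push_cast
        rw [hzu]
        ring
      · have hc' : (2 : ℚ) * (Nat.lcmUpto (2 * n - 1) : ℚ) = (Nat.lcmUpto (2 * n) : ℚ) * c := by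
          exact_mod_cast hc
        push_cast
        rw [hzv]
        have : (2 : ℚ) ^ (4 * n + 4) * (Nat.lcmUpto (2 * n - 1) : ℚ) ^ 2 * v n
            = 2 ^ (4 * n + 2) * (2 * (Nat.lcmUpto (2 * n - 1) : ℚ)) ^ 2 * v n := by ring
        rw [this, hc']
        ring

end Literature.NumberTheory.Irrationality.Zudilin2003
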